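import Summits.HodgeConjecture.HodgeConjecture.Theorems.WeilTypeLadderLocalAnchor
import Summits.HodgeConjecture.HodgeConjecture.Theorems.HeckePrymWeilHyperbolicEightfoldsSqrtMinus7EndAdditiveH1
import Literature.AlgebraicGeometry.Motives.AbelianVarietyCohomologyExteriorH1
import Literature.AlgebraicTopology.SingularHomology.CupProductExteriorH1
import HarnessLib

/-!
# WeilTypeLadder · the `d ↦ 4d` reduction on real carriers, and F0a from Markman's LITERAL regime (referee G17)

b2b cell `hweil` (packet `run/shared/lean/b2b/hodge-weil/`, `GAPS.md ## referee-g8` objection **G17**). Prover 2,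
generation 3. The claim-fact `Markman2025_secantAnchor_locallyAlgebraic_sixfold : ∀ d ≥ 1, HasLocallyAlgebraicWeilAnchor 3 d`
(p177378) renders Markman's local statement at the secant anchor for EVERY `d`, whereas the secant construction of
arXiv:2502.03415 is literal only for `d` EVEN, `d ≥ 4` (Thm. 1.4.1 needs `d ≥ 3`; the `Ḡ`-linearisation of §1.5 / §9.3
needs `d` even; footnote: "If `d` is odd replace it with `4d` and note that `ℚ(√-4d) = ℚ(√-d)`"); for the other `d` the
fact's anchor `(X × X̂, φ_d)` was justified by an isogeny transport that is NOT a sentence of the preprint (referee-g8,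
G17, repair option (1): "re-type the claim-fact in Markman's literal regime `∀ d, HasLocallyAlgebraicWeilAnchor 3 (4d)`
and move the transport to the summit side"). This file DOES THE TRANSPORT ON THE SUMMIT SIDE, kernel-checked, in the
form `(A, φ, d) ↦ (A, 2φ, 4d)` on the TARGETS (not on the anchor):

* `complexBetti_map_two_nsmul_one`, `complexBetti_map_two_nsmul` — for an endomorphism `φ` of a complex abelian
  variety, `(2φ)^* = 2·φ^*` on `H¹` (the tree's `stub_endAdditiveH1`: pull-back on `H¹` is additive) and hence
  `(2φ)^* = 2ᵏ·φ^*` on `Hᵏ` (`Hᵏ(A(ℂ)) = ⋀ᵏH¹`, spanned by products of degree-one classes —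
  `AbelianVariety.hasExteriorCohomologyH1_complexPoints`, `span_range_cupPowOne`, `map_cupPowOne`, multilinearity);
* `weilClassesOf_le_weilClassesOf_two_nsmul` — `weilClassesOf A φ n d ≤ weilClassesOf A (2φ) n (4d)` (the eigen-conditions
  for `x·𝟙 + y·(2φ)` are among those for `x·𝟙 + y'·φ`, and `√(4d) = 2√d`);
* `isHyperbolicWeilType_two_nsmul` — hyperbolicity of `(A, φ)` for `h_K = d·e^*a + φ^*e^*a` gives hyperbolicity of
  `(A, 2φ)` for `4d·e^*a + (2φ)^*e^*a = 4·h_K` (`isHyperbolicWeilType_smul_iff`; the frame's span is `2φ^*`-stable);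
* `weilClasses_algebraic_hyperbolic_of_localAnchor_four_mul` — reach ∧ `HasLocallyAlgebraicWeilAnchor n (4d)` ⟹ the
  Weil plane of every hyperbolic `(A, φ)` with `φ ≫ φ = -d` is algebraic (apply the `4d` composition of
  `Theorems/WeilTypeLadderLocalAnchor` to `(A, 2φ)`);
* **`markman2025_hyperbolicSixfold_of_reach_of_localAnchor_four_mul`** — F0a BY NAME from `weilFamilyReach_hyperbolic`
  and `∀ d ≥ 1, HasLocallyAlgebraicWeilAnchor 3 (4 * d)`, i.e. from the claim-fact RESTRICTED TO MARKMAN'S LITERAL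
  REGIME (`4d ∈ {4, 8, 12, …}` ⊂ {even, `≥ 4`}): feed it `fun d hd => hM (4 * d) _` for
  `hM : Markman2025_secantAnchor_locallyAlgebraic_sixfold` (the resulting statement `reach → fact → F0a` is, as a TYPE,
  the landed `markman2025_hyperbolicSixfold_of_reach_of_secantAnchor`, so it is not restated; the point is the PROOF:
  through this file the floor depends on the preprint only at `d' = 4d`, where the anchor `(X × X̂, φ_{4d}, 𝓑)` is
  verbatim Markman's, and the transport paragraph of p177378's docstring is not used).

No definition, no new named fact, sorry-free. Serves stmt-HodgeConjecture-2524 without closing it.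
-/

-- every declaration of this problem lives in `Summit.HodgeConjecture.HodgeConjecture.…` (summit = sub-problem)
set_option linter.dupNamespace false

noncomputable section

open CategoryTheory AlgebraicGeometry

namespace Summit.HodgeConjecture.HodgeConjecture.WeilTypeLadder

open Literature.AlgebraicGeometry Literature.AlgebraicGeometry.Motives
open Literature.AlgebraicGeometry.HodgeTheory
open Literature.AlgebraicTopology.SingularHomology
open Summit.HodgeConjecture.HodgeConjecture.Theorems.HyperbolicEightfoldsSqrtMinus7.DicyclicQuaternionSwitch
  (stub_endAdditiveH1)

/-! ## `(2φ)^*` on `H¹` and on `Hᵏ` -/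

/-- **`(2φ)^* = 2·φ^*` on `H¹(A(ℂ); ℂ)`**: `2 • φ = φ + φ` and pull-back on `H¹` of an abelian variety is additive in
the homomorphism (`stub_endAdditiveH1`, Lange–Birkenhake 1.1.2 / Lemma 1.1.17).
[cite: LangeBirkenhake1992, Ch. 1 §1 (1.1.2) and Lemma 1.1.17 (a)] -/
theorem complexBetti_map_two_nsmul_one (A : AbelianVariety ℂ) (φ : A ⟶ A) (v : complexBetti A.X 1) :
    complexBetti.map (2 • φ).hom.hom.hom 1 v = (2 : ℂ) • complexBetti.map φ.hom.hom.hom 1 v := by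
  rw [two_nsmul, stub_endAdditiveH1, two_smul]

/-- **`(2φ)^* = 2ᵏ·φ^*` on `Hᵏ(A(ℂ); ℂ)`**: `Hᵏ` is spanned by the products `v₁ ⌣ ⋯ ⌣ v_k` of degree-one classes
(`H•(A(ℂ)) = ⋀•H¹`, `AbelianVariety.hasExteriorCohomologyH1_complexPoints`), pull-back is multiplicative
(`map_cupPowOne`) and the iterated product is multilinear. [cite: LangeBirkenhake1992, Exercise 1.1.6 (7)]
[cite: HatcherAT2002, Prop. 3.10 and Example 3.16] -/
theorem complexBetti_map_two_nsmul (A : AbelianVariety ℂ) (φ : A ⟶ A) (k : ℕ) (x : complexBetti A.X k) :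
    complexBetti.map (2 • φ).hom.hom.hom k x = (2 : ℂ) ^ k • complexBetti.map φ.hom.hom.hom k x := by
  have hspan := (AbelianVariety.hasExteriorCohomologyH1_complexPoints A).span_range_cupPowOne k
  have key : (complexBetti.map (2 • φ).hom.hom.hom k).hom =
      (2 : ℂ) ^ k • (complexBetti.map φ.hom.hom.hom k).hom := by
    refine LinearMap.ext_on hspan ?_
    rintro _ ⟨v, rfl⟩
    change complexBetti.map (2 • φ).hom.hom.hom k (cupPowOne ℂ (ComplexPoints A.X) k v) =
      (2 : ℂ) ^ k • complexBetti.map φ.hom.hom.hom k (cupPowOne ℂ (ComplexPoints A.X) k v)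
    rw [complexBetti.map, map_cupPowOne, complexBetti.map, map_cupPowOne]
    have h2 : (fun i => singularCohomology.map ℂ ℂ (AlgPoints.mapContinuous (L := ℂ) (2 • φ).hom.hom.hom) 1 (v i)) =
        fun i => (2 : ℂ) • singularCohomology.map ℂ ℂ (AlgPoints.mapContinuous (L := ℂ) φ.hom.hom.hom) 1 (v i) := by
      funext i
      exact complexBetti_map_two_nsmul_one A φ (v i)
    rw [h2, MultilinearMap.map_smul_univ, Finset.prod_const, Finset.card_univ, Fintype.card_fin]
  have h := LinearMap.congr_fun key x
  simpa only [LinearMap.smul_apply] using h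

/-! ## The Weil plane and hyperbolicity under `φ ↦ 2φ`, `d ↦ 4d` -/

/-- `√(4d) = 2√d` in `ℂ` (real square roots of naturals). [folklore] -/
theorem sqrt_four_mul_natCast (d : ℕ) : (Real.sqrt ((4 * d : ℕ) : ℝ) : ℂ) = 2 * (Real.sqrt d : ℂ) := by
  have h4 : Real.sqrt 4 = 2 := by
    rw [show (4 : ℝ) = 2 ^ 2 by norm_num, Real.sqrt_sq (by norm_num)]
  rw [Nat.cast_mul, Nat.cast_ofNat, Real.sqrt_mul (by norm_num : (0 : ℝ) ≤ 4), h4]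
  push_cast
  ring

/-- **`weilClassesOf A φ n d ≤ weilClassesOf A (2φ) n (4d)`**: a joint eigenclass of all `(x·𝟙 + y·φ)^*` with
eigenvalues `(x ± iy√d)^{2n}` is one of all `(x·𝟙 + y·(2φ))^* = (x·𝟙 + (2y)·φ)^*` with eigenvalues
`(x ± iy√(4d))^{2n} = (x ± i(2y)√d)^{2n}`. (Both planes are `⋀^{2n}V₊ ⊕ ⋀^{2n}V₋` for the same `K = ℚ(√-d) = ℚ(√-4d)`;
only the inclusion is needed.) [cite: vanGeemen1994HodgeAV, 4.8–4.9] -/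
theorem weilClassesOf_le_weilClassesOf_two_nsmul (A : AbelianVariety ℂ) (φ : A ⟶ A) (n d : ℕ) :
    weilClassesOf A φ n d ≤ weilClassesOf A (2 • φ) n (4 * d) := by
  have hxy : ∀ x y : ℕ, (x • 𝟙 A + y • (2 • φ) : A ⟶ A) = x • 𝟙 A + (y * 2) • φ := by
    intro x y; rw [smul_smul]
  refine sup_le_sup ?_ ?_
  · intro c hc
    rw [mem_weilClassesPlus_iff] at hc ⊢
    intro x y
    rw [hxy, hc x (y * 2), sqrt_four_mul_natCast]
    push_cast
    ring_nf
  · intro c hc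
    rw [mem_weilClassesMinus_iff] at hc ⊢
    intro x y
    rw [hxy, hc x (y * 2), sqrt_four_mul_natCast]
    push_cast
    ring_nf

/-- **Hyperbolicity under `(φ, h_K) ↦ (2φ, 4h_K)`**: if `(A, φ)` is hyperbolic for `h_K = d·e^*a + φ^*e^*a` then
`(A, 2φ)` is hyperbolic for `4d·e^*a + (2φ)^*e^*a` — the latter is `4·h_K` (`(2φ)^* = 4φ^*` on `H²`), a non-zero
multiple (`isHyperbolicWeilType_smul_iff`), and a `φ^*`-stable frame is `(2φ)^* = 2φ^*`-stable.
[cite: vanGeemen1994HodgeAV, Lemma 5.2 and 5.4] -/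
theorem isHyperbolicWeilType_two_nsmul (A : AbelianVariety ℂ) (φ : A ⟶ A) (n d : ℕ)
    (e : ProjectiveEmbedding A.X) (a : complexBetti (projectiveSpace e.n ℂ) 2)
    (h : IsHyperbolicWeilType A φ n
      ((d : ℂ) • complexBetti.map e.ι 2 a + complexBetti.map φ.hom.hom.hom 2 (complexBetti.map e.ι 2 a))) :
    IsHyperbolicWeilType A (2 • φ) n
      (((4 * d : ℕ) : ℂ) • complexBetti.map e.ι 2 a +
        complexBetti.map (2 • φ).hom.hom.hom 2 (complexBetti.map e.ι 2 a)) := by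
  have h4 : ((4 * d : ℕ) : ℂ) • complexBetti.map e.ι 2 a +
      complexBetti.map (2 • φ).hom.hom.hom 2 (complexBetti.map e.ι 2 a) =
      (4 : ℂ) • ((d : ℂ) • complexBetti.map e.ι 2 a + complexBetti.map φ.hom.hom.hom 2 (complexBetti.map e.ι 2 a)) := by
    rw [complexBetti_map_two_nsmul, smul_add, smul_smul, Nat.cast_mul]
    norm_num
  rw [h4, isHyperbolicWeilType_smul_iff (by norm_num : (4 : ℂ) ≠ 0)]
  obtain ⟨u, hrat, hli, hstab, hiso⟩ := h
  refine ⟨u, hrat, hli, fun i => ?_, hiso⟩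
  rw [complexBetti_map_two_nsmul, pow_one]
  exact Submodule.smul_mem _ _ (hstab i)

/-! ## F0a from the local anchors at `4d` (Markman's literal regime) -/

/-- **Every hyperbolic `(A, φ)` with `φ ≫ φ = -d` from reach and ONE locally algebraic hyperbolic anchor at `4d`.**
Apply `weilClasses_algebraic_hyperbolic_of_localAnchor` at `(n, 4d)` to `(A, 2φ)` (`(2φ)² = -4d`, hyperbolic by
`isHyperbolicWeilType_two_nsmul`) and use `weilClassesOf A φ n d ≤ weilClassesOf A (2φ) n (4d)`.
[cite: Markman2025SecantWeil, §1.5 (footnote: d ↦ 4d)] [cite: Deligne1982HodgeCycles, proof of Thm. 4.8] -/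
theorem weilClasses_algebraic_hyperbolic_of_localAnchor_four_mul (n d : ℕ) (hn : 1 ≤ n) (hd : 1 ≤ d)
    (hL : HasLocallyAlgebraicWeilAnchor n (4 * d)) (hF : weilFamilyReach_hyperbolic)
    (A : AbelianVariety ℂ) (φ : A ⟶ A) (hA : A.dim = 2 * n) (hφ : φ ≫ φ = -(d • 𝟙 A))
    (eA : ProjectiveEmbedding A.X) (aA : complexBetti (projectiveSpace eA.n ℂ) 2) (haA : IsRationalClass aA)
    (haA0 : aA ≠ 0)
    (hhypA : IsHyperbolicWeilType A φ n
      ((d : ℂ) • complexBetti.map eA.ι 2 aA + complexBetti.map φ.hom.hom.hom 2 (complexBetti.map eA.ι 2 aA))) :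
    weilClassesOf A φ n d ≤ algebraicClasses A.X n := by
  have hφ2 : (2 • φ) ≫ (2 • φ) = -((4 * d) • 𝟙 A) := by
    rw [Preadditive.nsmul_comp, Preadditive.comp_nsmul, hφ, smul_smul, smul_neg, smul_smul]
    norm_num
  exact (weilClassesOf_le_weilClassesOf_two_nsmul A φ n d).trans
    (weilClasses_algebraic_hyperbolic_of_localAnchor n (4 * d) hn (by omega) hL hF A (2 • φ) hA hφ2 eA aA haA
      haA0 (isHyperbolicWeilType_two_nsmul A φ n d eA aA hhypA))

/-- **F0a BY NAME from reach and locally algebraic anchors in dimension 6 at every `4d`** (Markman's literal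
regime: `4d` even `≥ 4`; with `hL := fun d _ => hM (4 * d) _` for `hM : Markman2025_secantAnchor_locallyAlgebraic_sixfold`
this is the floor from the claim-fact used ONLY where the secant anchor is verbatim — referee G17, option (1), the
transport done kernel-side on the targets). [cite: Markman2025SecantWeil, Thm. 1.4.1, §1.5 (footnote) and Thm. 1.5.1]
[cite: Deligne1982HodgeCycles, proof of Thm. 4.8] -/
theorem markman2025_hyperbolicSixfold_of_reach_of_localAnchor_four_mul (hF : weilFamilyReach_hyperbolic)
    (hL : ∀ d : ℕ, 0 < d → HasLocallyAlgebraicWeilAnchor 3 (4 * d)) :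
    Markman2025_weilClasses_algebraic_hyperbolicSixfold := by
  intro d hd A φ hA _ hφ e a ha ha0 hhyp c _ _ hcW
  exact weilClasses_algebraic_hyperbolic_of_localAnchor_four_mul 3 d (by norm_num) hd (hL d hd) hF A φ hA hφ e a
    ha ha0 hhyp hcW

end Summit.HodgeConjecture.HodgeConjecture.WeilTypeLadder

end
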